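import Literature.MathematicalPhysics.QuantumFieldTheory.Balaban1983to89.T4CauchySum
import Literature.MathematicalPhysics.QuantumFieldTheory.Balaban1983to89.T4BookingNecessity

/-!
# BalabanUVNodes ∕ node N19′ (the `Summable δ` currency of the NE7 core edge) — THE AGE ⊛ SCALE ℓ¹-TRANSPORT BUDGET, PROVED:
# node U6's Cauchy sum with an ℓ¹ (instead of geometric) transport, Bałaban's healed-large-field activity as such a transport,
# its NON-geometric decay, and the summability of a large-field channel bound — the four `def … : Prop` statements of the crux idea
# card `age-scale-convolution` (evidence n°46∕n°47 on stmt-QuantumFields-20544) as theorems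

Cell `pub-ymgap` (HUMAN RULING D-0062 Track A ∕ D-0149 width seats), WIDTH SEAT `pub-ymgap-dag-n19-w1` (node n19 = NE7, seat 1 of 3), generation g3,
INTENT-3 (bus CLAIM-3 2026-08-28T03:33Z).  Route `Summits/QuantumFields/YangMills/Theses/BalabanUVNodes.lean`, key item K3⁷ `SpineGivenEndpointR13SepCoPH`
(stmt-QuantumFields-20544), whose v4 stub 2 `stub_expansion13H` carries the N19′ conjunct `KeyedCoreEdgeHolderD4 … → ∃ δ, NE7.Core … δ ∧ Summable δ`; filed
`--kind proof --supports … --as helper`.  COUNT-NEUTRAL.  THEOREMS ONLY (0 `def`, 0 `sorry`).  ADDITIVE — imports the tree's `…Balaban1983to89.T4CauchySum` (node U6: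
`InjectedRate`, `delta`, `summable_delta`, `summable_succ_pow_mul_geometric`) and `…T4BookingNecessity` (`tendsto_log_succ_atTop`) ONLY (Mathlib through them: `Summable.mul_of_nonneg`, `summable_sum_mul_antidiagonal_of_summable_mul`,
`Real.isLittleO_pow_log_id_atTop`, `Real.tendsto_log_atTop`, `Real.summable_nat_pow_inv`); modifies nothing.

WHY.  The ym-nodeO ideation lane's crux card `age-scale-convolution` (idea-3 g5, `Sketch.lean` sha16 c22e6b30a58e46e5, ns `YMNodeOIdeate.Idea3.AgeScaleConvolution`) and its
triage (CRIT-1 g4, `Cruxes/SpineGivenEndpointR13SepCoPH/CRIT-1-TRIAGE-age-scale-convolution.md`: «SURVIVES, priced … (a) the ℓ¹-transport edition is a 1-page Mathlib lemma set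
next to `T4CauchySum` — a typist's P1, PROVABLE NOW, harmless, and it strictly CONTAINS `summable_delta`») observe: in the two-run comparison behind the N19′ core edge, the
HEALED-LARGE-FIELD channel carries at AGE `n` (remaining scales) the activity `exp(−c₀·p₀(g)²)` with `p₀(g) = A₀ (log g⁻²)^{p₀}`, `p₀ ≥ 1` a positive integer — located by CRIT-1 at
[Balaban1988Convergent] CMP 119 p. 244 («the bound does NOT give any positive power of ε») ∕ p. 246 — which along the asymptotically free trajectory `g⁻² ≈ x₀ + b·n` reads
`a n = exp(−(A·log(x₀ + b·n))^{2p₀})`: summable in the age with every polynomial moment, but NOT `O(θ^n)` for any `θ < 1`.  Node U6's transported total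
`T4CauchySum.delta E ρ inj K = E·Σ_{j+n=K} inj K j·ρ^n` HARD-CODES a geometric transport `ρ^n`, so it cannot host that channel; its ℓ¹-TRANSPORT EDITION
`E·Σ_{j+n=K} inj K j·t n` with `Σ_n (n+1)^c·t n < ∞` can, and is summable in `K` by the discrete Young ∕ Mertens inequality for non-negative series.  The card typed the four
statements as `def … : Prop` («planners do not prove»); this file PROVES them, with the card's shapes UNFOLDED (no definition is introduced here: a definer may lift
`deltaT` ∕ `SummableTransport` ∕ `balabanActivity` to `Literature/…` and re-export the theorems below by `:=`).
* §1 [folklore] `summable_antidiagonal_of_nonneg` (Cauchy product of two non-negative ℓ¹ sequences on `ℕ`, Mathlib BY NAME) · `succ_cast_pow_le_mul_pow` (`(j+n+1)^c ≤ (j+1)^c·(n+1)^c`,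
  the polynomial asymptotic-freedom factor of `InjectedRate` splits over the antidiagonal).
* §2 [folklore] `transportedTotal_nonneg` · ★★ `summable_transportedTotal` = the card's `FirstLemma`: `0 ≤ E`, `0 ≤ C`, `0 ≤ θ < 1`, `InjectedRate C c θ inj`, `t ≥ 0`,
  `Summable ((n+1)^c·t n)` ⇒ `Summable (K ↦ E·Σ_{(j,n) ∈ antidiagonal K} inj K j·t n)` · `delta_eq_transportedTotal` (node U6's `delta` IS the instance `t n = ρ^n`, `rfl`) ·
  `summable_delta_of_transport` (the tree's `summable_delta` RECOVERED as that instance — the edition strictly contains it).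
* §3 [folklore] `balabanActivity_pos` · ★★ `summable_succ_pow_mul_balabanActivity` = `SecondLemma`: `0 < A`, `1 < x₀`, `0 < b`, `1 ≤ p₀` ⇒ for EVERY moment order `c`,
  `Summable ((n+1)^c · exp(−(A·log(x₀ + b·n))^{2p₀}))` (eventually `(A·log(x₀+bn))^{2p₀} ≥ (c+2)·log(n+1)`, comparison with `Σ (n+1)^{−2}`; the guard `1 ≤ p₀` is load-bearing —
  at `p₀ = 0` the activity is the constant `e^{−1}`).
* §4 [folklore] ★ `eventually_lt_balabanActivity` = `NotGeometric`: for every `θ ∈ ]0,1[` and `M`, eventually `M·θ^n < exp(−(A·log(x₀ + b·n))^{2p₀})` (`(log(n+1))^{2p₀} = o(n)`,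
  `Real.isLittleO_pow_log_id_atTop`) — so an `InjectedRate`-with-`ρ^n` typing of this channel is false as a hypothesis about the scheme, while the ℓ¹ typing is what print supports.
* §5 [folklore] ★ `summable_of_lfChannelBound` = `ThirdLemma` (its `0 ≤ vol`, `0 ≤ E` dropped as unnecessary): `u, a ∈ ℓ¹₊`, `0 ≤ δLF K ≤ vol·(E·Σ_{antidiagonal K} u_j·a_n + a (K+1))` for all `K` ⇒ `Summable δLF` —
  exactly the currency `NE7.Core … δ ∧ Summable δ` ∕ `HybridNE7.summable` consumes.
CHANNEL SPLIT (CRIT-1 (5)∕(d), located, nothing typed): serving the core edge's `δ` by `δSF + δLF` with both halves summable needs NO monotonicity of `NE7.Core` in `δ` if the producer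
sandwiches at radius `vol·(δSF + δLF)` directly (or composes two legs, dag-n19-e `N19CoreMetric.core_trans`); where monotonicity IS used, the tree's
`N19AtSpineCarriers.core_mono_delta` carries the positivity guard `0 ≤ P` on the good classes and `0 ≤ vol` — the hygiene gap CRIT-1 flags is closed by citing it, not by a new stub.

HONEST FRAMING.  Elementary real analysis [folklore] over hypothesis SHAPES (`InjectedRate`, an ℓ¹ transport, the LF-channel majorant); the activity formula is CONTEXT located in
print by CRIT-1 (nothing of Bałaban's is asserted — the channel bound `LFChannelBound` ∕ the card's K1–K2 remain unprinted HYPOTHESES; [B12] Thm 2 unproved in print); NE7 NOT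
PRINTED as a two-run statement for d = 4 ∕ NOT proved; N19 NOT discharged (0∕1); K3⁷ OPEN, not claimed; counts UNMOVED (typed 28∕28 · discharged 5∕27, A 5∕28).  Everything below is
PROVED (0 `sorry`, 0 named facts, standard axioms); no decl carries a cite tag.  One finite four-torus programme at fixed ε — NOT ℝ⁴, NOT infinite volume, NOT OS, NOT a mass gap,
NOT the Clay problem (R4 closes the conditional finite-𝕋⁴ rung `BalabanLadder.UV` only).
-/

noncomputable section

open Finset Filter Topology Asymptotics

namespace Summit.QuantumFields.YangMills.BalabanUVNodes.N19AgeScaleTransportBudget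

open Literature.MathematicalPhysics.QuantumFieldTheory.Balaban1983to89.T4CauchySum (InjectedRate delta summable_succ_pow_mul_geometric)
open Literature.MathematicalPhysics.QuantumFieldTheory.Balaban1983to89.T4BookingNecessity (tendsto_log_succ_atTop)

/-! ## §1 Cauchy products of non-negative ℓ¹ sequences; the polynomial factor splits over the antidiagonal [folklore] -/

/-- **CAUCHY PRODUCT OF NON-NEGATIVE ℓ¹ SEQUENCES** (discrete Young ∕ Mertens, non-negative case): `Σ_K Σ_{j+n=K} f j·g n < ∞` — Mathlib's
`summable_sum_mul_antidiagonal_of_summable_mul ∘ Summable.mul_of_nonneg` BY NAME. [folklore] -/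
theorem summable_antidiagonal_of_nonneg {f g : ℕ → ℝ} (hf : Summable f) (hg : Summable g) (hf0 : ∀ n, 0 ≤ f n) (hg0 : ∀ n, 0 ≤ g n) :
    Summable fun K : ℕ => ∑ p ∈ antidiagonal K, f p.1 * g p.2 :=
  summable_sum_mul_antidiagonal_of_summable_mul (hf.mul_of_nonneg hg (fun n => hf0 n) fun n => hg0 n)

/-- The asymptotic-freedom polynomial factor of `InjectedRate` SPLITS over the antidiagonal: `(j + n + 1)^c ≤ (j+1)^c·(n+1)^c` (since `j + n + 1 ≤ (j+1)(n+1)`). [folklore] -/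
theorem succ_cast_pow_le_mul_pow (j n c : ℕ) : (((j + n : ℕ) : ℝ) + 1) ^ c ≤ ((j : ℝ) + 1) ^ c * (((n : ℝ) + 1) ^ c) := by
  rw [← mul_pow]
  refine pow_le_pow_left₀ (by positivity) ?_ c
  have hj : (0 : ℝ) ≤ j := Nat.cast_nonneg j
  have hn : (0 : ℝ) ≤ n := Nat.cast_nonneg n
  push_cast
  nlinarith [mul_nonneg hj hn]

/-! ## §2 The ℓ¹-transport edition of node U6's Cauchy sum is summable (`FirstLemma`) [folklore] -/

section Transport
variable {E C θ : ℝ} {c : ℕ} {t : ℕ → ℝ} {inj : ℕ → ℕ → ℝ}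

/-- The transported total with a non-negative transport is non-negative under an injected rate. [folklore] -/
theorem transportedTotal_nonneg (hE : 0 ≤ E) (hinj : InjectedRate C c θ inj) (ht : ∀ n, 0 ≤ t n) (K : ℕ) :
    0 ≤ E * ∑ p ∈ antidiagonal K, inj K p.1 * t p.2 :=
  mul_nonneg hE (Finset.sum_nonneg fun p hp =>
    mul_nonneg (hinj K p.1 (by have := mem_antidiagonal.mp hp; omega)).1 (ht p.2))

/-- **★★ `FirstLemma` PROVED — THE ℓ¹-TRANSPORT EDITION OF NODE U6's CAUCHY SUM IS SUMMABLE** [folklore].  A discrepancy `inj K j` injected at scale `j ≤ K` at the GEOMETRIC rate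
`0 ≤ inj K j ≤ C·(K+1)^c·θ^j` (`T4CauchySum.InjectedRate`, `0 ≤ θ < 1`), transported to the last scale by a NON-NEGATIVE factor `t n` of the AGE `n = K − j` whose `c`-th moment is
summable (`Σ_n (n+1)^c·t n < ∞` — an ℓ¹ transport, e.g. Bałaban's healed-large-field activity, §3), has a summable total `Σ_K E·Σ_{j+n=K} inj K j·t n < ∞`: the factor `(K+1)^c =
(j+n+1)^c ≤ (j+1)^c·(n+1)^c` splits (§1), and what remains is the Cauchy product of `(j+1)^c θ^j ∈ ℓ¹₊` (`T4CauchySum.summable_succ_pow_mul_geometric`) with `(n+1)^c t n ∈ ℓ¹₊`. -/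
theorem summable_transportedTotal (hE : 0 ≤ E) (hC : 0 ≤ C) (hθ : 0 ≤ θ) (hθ1 : θ < 1) (hinj : InjectedRate C c θ inj)
    (ht : ∀ n, 0 ≤ t n) (hts : Summable fun n : ℕ => ((n : ℝ) + 1) ^ c * t n) :
    Summable fun K : ℕ => E * ∑ p ∈ antidiagonal K, inj K p.1 * t p.2 := by
  have hF : Summable fun j : ℕ => ((j : ℝ) + 1) ^ c * θ ^ j := summable_succ_pow_mul_geometric hθ hθ1 c
  have hprod := summable_antidiagonal_of_nonneg hF hts (fun j => by positivity) fun n => mul_nonneg (by positivity) (ht n)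
  refine Summable.of_nonneg_of_le (fun K => transportedTotal_nonneg hE hinj ht K) (fun K => ?_) (hprod.mul_left (E * C))
  rw [mul_assoc]
  refine mul_le_mul_of_nonneg_left ?_ hE
  rw [Finset.mul_sum]
  refine Finset.sum_le_sum fun p hp => ?_
  have hjn : p.1 + p.2 = K := mem_antidiagonal.mp hp
  obtain ⟨-, hle⟩ := hinj K p.1 (by omega)
  have hK : ((K : ℝ) + 1) ^ c ≤ ((p.1 : ℝ) + 1) ^ c * (((p.2 : ℝ) + 1) ^ c) := by
    have h := succ_cast_pow_le_mul_pow p.1 p.2 c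
    rwa [hjn] at h
  calc inj K p.1 * t p.2 ≤ (C * ((K : ℝ) + 1) ^ c * θ ^ p.1) * t p.2 := mul_le_mul_of_nonneg_right hle (ht p.2)
    _ ≤ (C * (((p.1 : ℝ) + 1) ^ c * (((p.2 : ℝ) + 1) ^ c)) * θ ^ p.1) * t p.2 :=
        mul_le_mul_of_nonneg_right (mul_le_mul_of_nonneg_right (mul_le_mul_of_nonneg_left hK hC) (pow_nonneg hθ _)) (ht p.2)
    _ = C * ((((p.1 : ℝ) + 1) ^ c * θ ^ p.1) * ((((p.2 : ℝ) + 1) ^ c) * t p.2)) := by ring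

/-- Node U6's transported total `T4CauchySum.delta E ρ inj` IS the ℓ¹-transport edition at the GEOMETRIC transport `t n = ρ^n` (definitional). [folklore] -/
theorem delta_eq_transportedTotal (E ρ : ℝ) (inj : ℕ → ℕ → ℝ) (K : ℕ) :
    delta E ρ inj K = E * ∑ p ∈ antidiagonal K, inj K p.1 * ρ ^ p.2 :=
  rfl

/-- **THE EDITION STRICTLY CONTAINS NODE U6's `summable_delta`**: at `t n = ρ^n`, `0 ≤ ρ < 1`, the moment hypothesis is `T4CauchySum.summable_succ_pow_mul_geometric` and §2 returns
`Summable (delta E ρ inj)` — the tree's `summable_delta`, re-derived through the ℓ¹ road. [folklore] -/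
theorem summable_delta_of_transport (hE : 0 ≤ E) (hC : 0 ≤ C) (hθ : 0 ≤ θ) (hθ1 : θ < 1) (hinj : InjectedRate C c θ inj) {ρ : ℝ} (hρ : 0 ≤ ρ) (hρ1 : ρ < 1) :
    Summable (delta E ρ inj) :=
  summable_transportedTotal hE hC hθ hθ1 hinj (fun n => pow_nonneg hρ n) (summable_succ_pow_mul_geometric hρ hρ1 c)

end Transport

/-! ## §3 Bałaban's healed-large-field activity is an ℓ¹ transport of every moment order (`SecondLemma`) [folklore] -/

section Activity
variable {A x₀ b : ℝ} {p₀ : ℕ}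

/-- The activity `exp(−(A·log(x₀ + b·n))^{2p₀})` is positive. [folklore] -/
theorem balabanActivity_pos (A x₀ b : ℝ) (p₀ n : ℕ) : 0 < Real.exp (-((A * Real.log (x₀ + b * n)) ^ (2 * p₀))) :=
  Real.exp_pos _

/-- **★★ `SecondLemma` PROVED — THE ACTIVITY IS AN AGE-SUMMABLE TRANSPORT FOR EVERY MOMENT ORDER** [folklore].  For `0 < A`, `1 < x₀`, `0 < b`, `1 ≤ p₀` and every `c : ℕ`,
`Σ_n (n+1)^c · exp(−(A·log(x₀ + b·n))^{2p₀}) < ∞`.  Proof: with `m := min x₀ b`, `x₀ + b·n ≥ m·(n+1)`, so `log(x₀ + b·n) ≥ log(n+1)∕2` once `log(n+1) ≥ −2·log m`; for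
`log(n+1) ≥ max(1, (c+2)∕(A∕2)^{2p₀})` this gives `(A·log(x₀+bn))^{2p₀} ≥ (A∕2)^{2p₀}·log(n+1)^{2p₀} ≥ (A∕2)^{2p₀}·log(n+1)² ≥ (c+2)·log(n+1)` (here `2p₀ ≥ 2` — the guard `1 ≤ p₀` is
load-bearing: at `p₀ = 0` the activity is the constant `e^{−1}`), whence the term is `≤ (n+1)^{−2}` eventually. -/
theorem summable_succ_pow_mul_balabanActivity (hA : 0 < A) (hx₀ : 1 < x₀) (hb : 0 < b) (hp₀ : 1 ≤ p₀) (c : ℕ) :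
    Summable fun n : ℕ => ((n : ℝ) + 1) ^ c * Real.exp (-((A * Real.log (x₀ + b * n)) ^ (2 * p₀))) := by
  have hm0 : 0 < min x₀ b := lt_min (lt_trans zero_lt_one hx₀) hb
  have hxn : ∀ n : ℕ, min x₀ b * ((n : ℝ) + 1) ≤ x₀ + b * n := fun n => by
    have h1 : min x₀ b ≤ x₀ := min_le_left _ _
    have h2 : min x₀ b ≤ b := min_le_right _ _
    have hn : (0 : ℝ) ≤ n := Nat.cast_nonneg n
    nlinarith
  have hκ0 : 0 < (A / 2) ^ (2 * p₀) := by positivity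
  have hev : ∀ᶠ n : ℕ in atTop, max 1 (max (-2 * Real.log (min x₀ b)) (((c : ℝ) + 2) / (A / 2) ^ (2 * p₀))) ≤ Real.log ((n : ℝ) + 1) :=
    tendsto_log_succ_atTop.eventually_ge_atTop _
  -- comparison series `Σ (n+1)^{−2}` (the tree's `T4CauchySum` road; cf. `Literature.NumberTheory.Transcendental.MZV.summable_inv_succ_sq`)
  have hcmp : Summable fun n : ℕ => (((n : ℝ) + 1) ^ 2)⁻¹ := by
    have h := (summable_nat_add_iff (G := ℝ) 1).mpr (Real.summable_nat_pow_inv.mpr one_lt_two)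
    simpa [Nat.cast_add, Nat.cast_one] using h
  refine Summable.of_norm_bounded_eventually_nat hcmp (hev.mono fun n hn => ?_)
  have hL1 : 1 ≤ Real.log ((n : ℝ) + 1) := (le_max_left _ _).trans hn
  have hL2 : -2 * Real.log (min x₀ b) ≤ Real.log ((n : ℝ) + 1) := ((le_max_left _ _).trans (le_max_right _ _)).trans hn
  have hL3 : ((c : ℝ) + 2) / (A / 2) ^ (2 * p₀) ≤ Real.log ((n : ℝ) + 1) := ((le_max_right _ _).trans (le_max_right _ _)).trans hn
  have hn1 : (0 : ℝ) < (n : ℝ) + 1 := by positivity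
  -- the argument of the activity is at least half of `log (n+1)`
  have hy : Real.log ((n : ℝ) + 1) / 2 ≤ Real.log (x₀ + b * n) := by
    have h := Real.log_le_log (mul_pos hm0 hn1) (hxn n)
    rw [Real.log_mul hm0.ne' hn1.ne'] at h
    linarith
  -- the exponent dominates `(c+2)·log(n+1)`
  have hpow : ((c : ℝ) + 2) * Real.log ((n : ℝ) + 1) ≤ (A * Real.log (x₀ + b * n)) ^ (2 * p₀) := by
    have hAL : 0 ≤ A / 2 * Real.log ((n : ℝ) + 1) := mul_nonneg (by positivity) (by linarith)
    have h1 : (A / 2 * Real.log ((n : ℝ) + 1)) ^ (2 * p₀) ≤ (A * Real.log (x₀ + b * n)) ^ (2 * p₀) :=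
      pow_le_pow_left₀ hAL (by nlinarith) _
    have hc2 : (c : ℝ) + 2 ≤ (A / 2) ^ (2 * p₀) * Real.log ((n : ℝ) + 1) := by
      have h := (div_le_iff₀ hκ0).mp hL3
      linarith
    have hLL : Real.log ((n : ℝ) + 1) ^ 2 ≤ Real.log ((n : ℝ) + 1) ^ (2 * p₀) := pow_le_pow_right₀ hL1 (by omega)
    calc ((c : ℝ) + 2) * Real.log ((n : ℝ) + 1) ≤ ((A / 2) ^ (2 * p₀) * Real.log ((n : ℝ) + 1)) * Real.log ((n : ℝ) + 1) :=
          mul_le_mul_of_nonneg_right hc2 (by linarith)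
      _ = (A / 2) ^ (2 * p₀) * Real.log ((n : ℝ) + 1) ^ 2 := by ring
      _ ≤ (A / 2) ^ (2 * p₀) * Real.log ((n : ℝ) + 1) ^ (2 * p₀) := mul_le_mul_of_nonneg_left hLL hκ0.le
      _ = (A / 2 * Real.log ((n : ℝ) + 1)) ^ (2 * p₀) := by rw [mul_pow]
      _ ≤ (A * Real.log (x₀ + b * n)) ^ (2 * p₀) := h1
  -- hence the activity is at most `(n+1)^{−(c+2)}`
  have hexp : Real.exp (-((A * Real.log (x₀ + b * n)) ^ (2 * p₀))) ≤ (((n : ℝ) + 1) ^ (c + 2))⁻¹ := by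
    rw [← Real.exp_log (pow_pos hn1 (c + 2)), ← Real.exp_neg, Real.exp_le_exp, Real.log_pow, neg_le_neg_iff]
    push_cast
    exact hpow
  have hn0 : (n : ℝ) + 1 ≠ 0 := hn1.ne'
  rw [Real.norm_of_nonneg (mul_nonneg (pow_nonneg hn1.le c) (Real.exp_pos _).le)]
  calc ((n : ℝ) + 1) ^ c * Real.exp (-((A * Real.log (x₀ + b * n)) ^ (2 * p₀))) ≤ ((n : ℝ) + 1) ^ c * (((n : ℝ) + 1) ^ (c + 2))⁻¹ :=
        mul_le_mul_of_nonneg_left hexp (pow_nonneg hn1.le c)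
    _ = (((n : ℝ) + 1) ^ 2)⁻¹ := by
        field_simp
        ring

/-! ## §4 … but it is NOT geometrically small (`NotGeometric`) [folklore] -/

/-- **★ `NotGeometric` PROVED — NODE U6's GEOMETRIC `delta ρ` CANNOT HOST THIS CHANNEL** [folklore].  For `0 < A`, `1 < x₀`, `0 < b`, every `θ ∈ ]0,1[` and every `M`, eventually
`M·θ^n < exp(−(A·log(x₀ + b·n))^{2p₀})`: `log(x₀ + bn) ≤ log(x₀+b) + log(n+1) ≤ 2·log(n+1)` eventually and `log(n+1)^{2p₀} = o(n+1)` (`Real.isLittleO_pow_log_id_atTop`), so the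
exponent is eventually below `(−log θ)·n∕2 < (−log θ)·n − log M`.  (No hypothesis on `p₀`.) -/
theorem eventually_lt_balabanActivity (hA : 0 < A) (hx₀ : 1 < x₀) (hb : 0 < b) (p₀ : ℕ) {θ : ℝ} (hθ : 0 < θ) (hθ1 : θ < 1) (M : ℝ) :
    ∃ N : ℕ, ∀ n ≥ N, M * θ ^ n < Real.exp (-((A * Real.log (x₀ + b * n)) ^ (2 * p₀))) := by
  have hκ : 0 < -Real.log θ := neg_pos.mpr (Real.log_neg hθ hθ1)
  have hc₁ : 0 < Real.log (x₀ + b) := Real.log_pos (by linarith)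
  have h2A : 0 < (2 * A) ^ (2 * p₀) := by positivity
  -- (E1) log(n+1) ≥ log(x₀ + b) eventually
  have E1 : ∀ᶠ n : ℕ in atTop, Real.log (x₀ + b) ≤ Real.log ((n : ℝ) + 1) := tendsto_log_succ_atTop.eventually_ge_atTop _
  -- (E2) log(n+1)^{2p₀} ≤ ε·(n+1) eventually, ε := (−log θ) ∕ (4·(2A)^{2p₀})
  have hlo := Real.isLittleO_pow_log_id_atTop (n := 2 * p₀) |>.comp_tendsto
    (tendsto_atTop_add_const_right atTop (1 : ℝ) tendsto_natCast_atTop_atTop)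
  have E2 : ∀ᶠ n : ℕ in atTop, Real.log ((n : ℝ) + 1) ^ (2 * p₀) ≤ -Real.log θ / (4 * (2 * A) ^ (2 * p₀)) * ((n : ℝ) + 1) := by
    filter_upwards [hlo.def (by positivity : (0 : ℝ) < -Real.log θ / (4 * (2 * A) ^ (2 * p₀)))] with n hn
    have hn1 : (0 : ℝ) ≤ (n : ℝ) + 1 := by positivity
    have hL0 : 0 ≤ Real.log ((n : ℝ) + 1) := Real.log_nonneg (by linarith)
    simpa only [Function.comp, id, Real.norm_of_nonneg (pow_nonneg hL0 _), Real.norm_of_nonneg hn1] using hn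
  -- (E3) 2·log M < (−log θ)·n and 1 ≤ n eventually
  have E3 : ∀ᶠ n : ℕ in atTop, 2 * Real.log M < -Real.log θ * n ∧ (1 : ℝ) ≤ n := by
    have ht : Tendsto (fun n : ℕ => -Real.log θ * (n : ℝ)) atTop atTop := tendsto_natCast_atTop_atTop.const_mul_atTop hκ
    exact (ht.eventually_gt_atTop _).and (tendsto_natCast_atTop_atTop.eventually_ge_atTop (1 : ℝ))
  obtain ⟨N, hN⟩ := eventually_atTop.mp (E1.and (E2.and E3))
  refine ⟨N, fun n hn => ?_⟩
  obtain ⟨h1, h2, h3, h4⟩ := hN n hn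
  have hn1 : (0 : ℝ) < (n : ℝ) + 1 := by positivity
  have hxpos : 0 < x₀ + b * n := by positivity
  -- the activity's exponent is at most (−log θ)·n∕2
  have hy0 : 0 ≤ Real.log (x₀ + b * n) := Real.log_nonneg (by nlinarith [(Nat.cast_nonneg n : (0 : ℝ) ≤ n)])
  have hy : Real.log (x₀ + b * n) ≤ 2 * Real.log ((n : ℝ) + 1) := by
    have hle : x₀ + b * n ≤ (x₀ + b) * ((n : ℝ) + 1) := by nlinarith [(Nat.cast_nonneg n : (0 : ℝ) ≤ n)]
    have h := Real.log_le_log hxpos hle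
    rw [Real.log_mul (by linarith) hn1.ne'] at h
    linarith
  have hexpo : (A * Real.log (x₀ + b * n)) ^ (2 * p₀) ≤ -Real.log θ * n / 2 := by
    calc (A * Real.log (x₀ + b * n)) ^ (2 * p₀) ≤ (A * (2 * Real.log ((n : ℝ) + 1))) ^ (2 * p₀) :=
          pow_le_pow_left₀ (mul_nonneg hA.le hy0) (mul_le_mul_of_nonneg_left hy hA.le) _
      _ = (2 * A) ^ (2 * p₀) * Real.log ((n : ℝ) + 1) ^ (2 * p₀) := by rw [← mul_pow]; ring
      _ ≤ (2 * A) ^ (2 * p₀) * (-Real.log θ / (4 * (2 * A) ^ (2 * p₀)) * ((n : ℝ) + 1)) := mul_le_mul_of_nonneg_left h2 h2A.le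
      _ = -Real.log θ * ((n : ℝ) + 1) / 4 := by field_simp
      _ ≤ -Real.log θ * n / 2 := by nlinarith
  rcases le_or_gt M 0 with hM | hM
  · exact (mul_nonpos_of_nonpos_of_nonneg hM (pow_nonneg hθ.le n)).trans_lt (Real.exp_pos _)
  · have hMθ : M * θ ^ n = Real.exp (Real.log M + n * Real.log θ) := by
      rw [Real.exp_add, Real.exp_log hM, Real.exp_nat_mul, Real.exp_log hθ]
    rw [hMθ, Real.exp_lt_exp]
    nlinarith

end Activity

/-! ## §5 A large-field channel bound with ℓ¹ letters gives a summable remainder (`ThirdLemma`) [folklore] -/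

/-- **★ `ThirdLemma` PROVED** [folklore].  If the healed-large-field part `δLF K` of the two-run core discrepancy is majorised by
`vol·(E·Σ_{j+n=K} u j·a n + a (K+1))` with `u, a ∈ ℓ¹₊` (scale-injected discrepancy ⊛ age-activity, plus run B's unmatched birth-scale activity), then `Summable δLF` (the
card's side conditions `0 ≤ vol`, `0 ≤ E` are not needed) — the currency the core edge `∃ δ, NE7.Core … δ ∧ Summable δ` ∕ `HybridNE7.summable` consumes (Cauchy product §1 + index shift).  The majorant `LFChannelBound` itself
is the card's unprinted physics claim and stays a HYPOTHESIS. -/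
theorem summable_of_lfChannelBound {vol E : ℝ} {u a δLF : ℕ → ℝ} (hu0 : ∀ j, 0 ≤ u j) (hu : Summable u)
    (ha0 : ∀ n, 0 ≤ a n) (ha : Summable a)
    (h : ∀ K, 0 ≤ δLF K ∧ δLF K ≤ vol * (E * (∑ p ∈ antidiagonal K, u p.1 * a p.2) + a (K + 1))) :
    Summable δLF :=
  Summable.of_nonneg_of_le (fun K => (h K).1) (fun K => (h K).2)
    ((((summable_antidiagonal_of_nonneg hu ha hu0 ha0).mul_left E).add ((summable_nat_add_iff (G := ℝ) 1).mpr ha)).mul_left vol)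

end Summit.QuantumFields.YangMills.BalabanUVNodes.N19AgeScaleTransportBudget

end
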